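import Summits.BirchSwinnertonDyer.BirchSwinnertonDyer.Theorems.GenusKolyvaginAtTwoPowDvdShaCardAtTwoRTRungDescentTwin
import Summits.BirchSwinnertonDyer.BirchSwinnertonDyer.Theorems.GenusKolyvaginAtTwoPowDvdShaCardAtTwoRTRungDescentKummer
import Summits.BirchSwinnertonDyer.BirchSwinnertonDyer.Theorems.GenusKolyvaginAtTwoPowDvdShaCardAtTwoRTRelaxedRung
import Mathlib.Algebra.Group.Subgroup.Finsupp
import HarnessLib

/-!
# Route `GenusKolyvaginAtTwo`, LINE 18 (L_T `PowDvdShaCardAtTwoRT`, stmt-BirchSwinnertonDyer-23242), stub L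
# `stub_twinShaLaddersAtTwo` — A RUNG OF EITHER LADDER FROM McCALLUM-SHAPED AVOIDANCE OVER `K` (the K-side rung theorem)

Seat `bsd-line-gk2-p2` g18 (PROVER seat 2/3, cell `bsd-f1-sign2`), `--supports stmt-BirchSwinnertonDyer-23242` (helper; closes
nothing). THEOREMS ONLY (no definition, no named fact, no `sorry`); BSD is not proved by any of this.

WHY. With the descent layer (`…RTRungDescent`, `…RTRungDescentTwin`, `…RTRungDescentKummer`) a rung of L is a K-side statement. This
file states that K-side statement in the SHAPE McCallum's Proposition 5.2 delivers — «for every subgroup `C` generated by the classes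
found so far (and, on the even side, by `c_L(1) = δ(P_1)`), some admissible class of order `2^a` has `⟨c⟩ ∩ C = 0`» — and proves that
it yields L's families `hfam` / `hfam'` VERBATIM. The admissible classes are those of a PREDICATE `P` on `H¹(K, E_K[2^L])` — for the
consumer: `P y ↔ y ∈ Sel^{(2^L)}(E_K/K) ∧ τ y = ±y` (Kolyvagin's `d_{M_{r−1}}(n)`: Selmer by Lemma 4.3 + Prop. 4.4 + minimality, signed
by Gross Prop. 5.4, of order `2^{M_{r−1}−M_r}` by the order law) — so the only arithmetic left per rung is the avoidance supply itself
(McCallum Prop. 5.2 over `K` at `2`: the route's engines).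

* §1 `exists_indepFamilyMod_of_forall_exists_avoiding` — the greedy lemma «avoidance ⟹ independence» MODULO A SEED SUBGROUP `C₀`
  (output: `∑ cₖ xₖ ∈ C₀ ⟹ 2^a ∣ cₖ`, i.e. independence AND `span ∩ C₀ = 0`); `disjoint_closure_range_of_indepMod`;
  `dvd_of_zsmul_add_sum_mem_of_disjoint` (McCallum's `⟨c⟩ ∩ C = 0` ⟹ the greedy's avoidance clause).
* §2 **`exists_shaFamily_W_of_forall_exists_avoiding`** — (+) side: `W/ℚ` with `W(ℚ)` `2^L`-divisible (rank `0`, odd torsion: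
  `exists_zsmul_two_pow_eq_of_rank_zero_of_odd_torsionOrder`), `E(K)[2^L] = 0`; if every `< s` fixed Selmer classes of order `2^a` are
  avoided by a fixed Selmer class of order `2^a`, then L's `hfam` rung: `∃ x : Fin s → W.galH1`, `res_K x_i ∈ Ш(W_K)`, orders `2^a`,
  independent.
* §3 **`exists_shaFamily_twin_of_forall_exists_avoiding`** — (−) side: `Wd` any ℚ-model of `W^{(d_K)}`, `g` a generator of `E(K)`
  modulo `2^L`, `P₀ ∈ E(K)` with `2^L ∤ P₀` (`P₀ = P_1`, `L > M₀`); if every `< s` anti-fixed Selmer classes of order `2^a` are avoided,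
  TOGETHER WITH `δ(P₀)`, by an anti-fixed Selmer class of order `2^a`, then L's `hfam'` rung: `∃ y : Fin s → Wd.galH1`,
  `res_K y_i ∈ Ш(Wd_K)`, orders `2^a`, independent.

References: [McCallumLMS1991] §5 Prop. 5.2, Thm. 5.4 (p. 310, «simple induction»); [GrossLMS1991] §5 (5.1), Prop. 5.4;
[Kolyvagin1991MathAnn] Thm. 1.
-/

set_option autoImplicit false
-- the Theorems namespace of this sub repeats the summit name by design (D-0017 nested layout)
set_option linter.dupNamespace false

noncomputable section

open scoped Classical

namespace Summit.BirchSwinnertonDyer.BirchSwinnertonDyer.Theorems.GenusExact.PlusDescent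

open WeierstrassCurve NumberField Field Literature.NumberTheory.EllipticCurves
  Literature.NumberTheory.GaloisRepresentations AddSubgroup

/-! ## §1 The greedy lemma modulo a seed subgroup -/

section Greedy

variable {A : Type*} [AddCommGroup A]

/-- **Avoidance builds independent families, modulo a seed subgroup `C₀`.** If for every `i < s` and every family `x₀,…,x_{i−1}` of
`P`-elements of order `N`, independent modulo `C₀` (`∑ cₖ xₖ ∈ C₀ ⇒ N ∣ cₖ`), some `P`-element `y` of order `N` avoids `⟨x⟩ + C₀`
(`m•y + ∑ cₖ xₖ ∈ C₀ ⇒ N ∣ m`), then there is a family of `s` `P`-elements of order `N` independent modulo `C₀`. McCallum's «simple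
induction» with the seed `C₀ = ⟨c_M(1)⟩` on the Mordell–Weil side (`C₀ = 0` on the rank-zero side).
[cite: McCallumLMS1991, §5 Prop. 5.2 and p. 310] -/
theorem exists_indepFamilyMod_of_forall_exists_avoiding {N s : ℕ} (P : A → Prop) (C₀ : AddSubgroup A)
    (havoid : ∀ i < s, ∀ x : Fin i → A, (∀ k, P (x k)) → (∀ k, addOrderOf (x k) = N) →
      (∀ c : Fin i → ℤ, ∑ k, c k • x k ∈ C₀ → ∀ k, (N : ℤ) ∣ c k) →
      ∃ y : A, P y ∧ addOrderOf y = N ∧ ∀ (m : ℤ) (c : Fin i → ℤ), m • y + ∑ k, c k • x k ∈ C₀ → (N : ℤ) ∣ m) :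
    ∃ x : Fin s → A, (∀ k, P (x k)) ∧ (∀ k, addOrderOf (x k) = N) ∧
      ∀ c : Fin s → ℤ, ∑ k, c k • x k ∈ C₀ → ∀ k, (N : ℤ) ∣ c k := by
  suffices h : ∀ i ≤ s, ∃ x : Fin i → A, (∀ k, P (x k)) ∧ (∀ k, addOrderOf (x k) = N) ∧
      ∀ c : Fin i → ℤ, ∑ k, c k • x k ∈ C₀ → ∀ k, (N : ℤ) ∣ c k from h s le_rfl
  intro i
  induction i with
  | zero =>
    intro _
    exact ⟨fun k ↦ k.elim0, fun k ↦ k.elim0, fun k ↦ k.elim0, fun c _ k ↦ k.elim0⟩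
  | succ i ih =>
    intro hi
    obtain ⟨x, hP, hord, hind⟩ := ih (Nat.le_of_succ_le hi)
    obtain ⟨y, hPy, hy, hav⟩ := havoid i (Nat.lt_of_succ_le hi) x hP hord hind
    refine ⟨Fin.snoc x y, fun k ↦ ?_, fun k ↦ ?_, fun c hc ↦ ?_⟩
    · refine Fin.lastCases ?_ (fun k ↦ ?_) k
      · simpa using hPy
      · simpa using hP k
    · refine Fin.lastCases ?_ (fun k ↦ ?_) k
      · simpa using hy
      · simpa using hord k
    · rw [Fin.sum_univ_castSucc] at hc
      simp only [Fin.snoc_castSucc, Fin.snoc_last] at hc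
      have hlast : (N : ℤ) ∣ c (Fin.last i) := by
        refine hav (c (Fin.last i)) (fun k ↦ c (Fin.castSucc k)) ?_
        rwa [add_comm]
      have hy0 : c (Fin.last i) • y = 0 := by
        obtain ⟨q, hq⟩ := hlast
        rw [hq, mul_comm, mul_smul, natCast_zsmul, ← hy, addOrderOf_nsmul_eq_zero, smul_zero]
      rw [hy0, add_zero] at hc
      have hrest := hind (fun k ↦ c (Fin.castSucc k)) hc
      intro k
      refine Fin.lastCases ?_ (fun k ↦ ?_) k
      · exact hlast
      · exact hrest k

/-- Independence modulo `C₀` gives `span ∩ C₀ = 0` (for elements of order `N`). [folklore] -/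
theorem disjoint_closure_range_of_indepMod {N s : ℕ} (C₀ : AddSubgroup A) (x : Fin s → A)
    (hord : ∀ k, addOrderOf (x k) = N) (hind : ∀ c : Fin s → ℤ, ∑ k, c k • x k ∈ C₀ → ∀ k, (N : ℤ) ∣ c k) :
    Disjoint (AddSubgroup.closure (Set.range x)) C₀ := by
  rw [disjoint_def]
  intro w hw hwC
  obtain ⟨a, rfl⟩ := (AddSubgroup.mem_closure_range_iff_of_fintype).mp hw
  refine Finset.sum_eq_zero fun k _ ↦ ?_
  obtain ⟨q, hq⟩ := hind a hwC k
  rw [hq, mul_comm, mul_smul, natCast_zsmul, ← hord k, addOrderOf_nsmul_eq_zero, smul_zero]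

/-- Independence modulo `C₀` gives independence. [folklore] -/
theorem indep_of_indepMod {N s : ℕ} (C₀ : AddSubgroup A) (x : Fin s → A)
    (hind : ∀ c : Fin s → ℤ, ∑ k, c k • x k ∈ C₀ → ∀ k, (N : ℤ) ∣ c k) :
    ∀ c : Fin s → ℤ, ∑ k, c k • x k = 0 → ∀ k, (N : ℤ) ∣ c k :=
  fun c hc ↦ hind c (by rw [hc]; exact C₀.zero_mem)

/-- **McCallum's `⟨y⟩ ∩ (⟨x⟩ + C₀) = 0` is the greedy's avoidance clause**: if `y` has order `N` and `⟨y⟩` meets `⟨x₀,…,x_{i−1}⟩ ⊔ C₀`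
trivially, then `m•y + ∑ cₖ xₖ ∈ C₀ ⇒ N ∣ m`. [cite: McCallumLMS1991, §5 Prop. 5.2] -/
theorem dvd_of_zsmul_add_sum_mem_of_disjoint {N i : ℕ} (C₀ : AddSubgroup A) (x : Fin i → A) {y : A}
    (hy : addOrderOf y = N) (hdisj : Disjoint (zmultiples y) (AddSubgroup.closure (Set.range x) ⊔ C₀))
    (m : ℤ) (c : Fin i → ℤ) (hmc : m • y + ∑ k, c k • x k ∈ C₀) : (N : ℤ) ∣ m := by
  rw [← hy, addOrderOf_dvd_iff_zsmul_eq_zero]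
  refine (disjoint_def.mp hdisj) (mem_zmultiples_iff.mpr ⟨m, rfl⟩) ?_
  -- `m • y = -(∑ cₖ xₖ) + (m•y + ∑ cₖ xₖ) ∈ ⟨x⟩ ⊔ C₀`
  have hsum : ∑ k, c k • x k ∈ AddSubgroup.closure (Set.range x) :=
    sum_mem fun k _ ↦ zsmul_mem (subset_closure (Set.mem_range_self k)) _
  have : m • y = -(∑ k, c k • x k) + (m • y + ∑ k, c k • x k) := by abel
  rw [this]
  exact add_mem (mem_sup_left (neg_mem hsum)) (mem_sup_right hmc)

end Greedy

/-! ## §2 The (+) side: a rung of the `W`-ladder from avoidance among fixed Selmer classes over `K` -/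

section PlusSide

variable (W : WeierstrassCurve ℚ) [W.IsElliptic] (K : Type) [Field K] [NumberField K]
  (h2 : Module.finrank ℚ K = 2) (σ : K ≃ₐ[ℚ] K) (hσ : σ ≠ 1) (n : ℤ)

include h2 hσ in
/-- **A RUNG OF L's `W`-LADDER FROM McCALLUM-SHAPED AVOIDANCE OVER `K` (rank-zero side).** `K` quadratic, `σ ≠ 1`, `n ≠ 0`,
`W(ℚ)` `n`-divisible (rank `0` and torsion prime to `n`: then `H¹(ℚ, W[n]) ↪ H¹(ℚ, W)`, `torsionH1ToH1_injective_of_divisible`),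
`W(K)[n] = 0`. If for every `i < s` and every `i` FIXED SELMER classes `u_k ∈ H¹(K, W_K[n])` of order `2^a` some fixed Selmer class
`y` of order `2^a` has `⟨y⟩ ∩ ⟨u⟩ = 0`, then there are `x : Fin s → H¹(ℚ, W)` with `res_K x_i ∈ Ш(W_K/K)`, `ord x_i = 2^a`,
independent modulo `2^a` — the binder `hfam` of stub L at this rung. (Supplier: `y = d_{M_{r−1}}(n)`, McCallum Prop. 5.2 over `K`
at `2` for the fixed sign.) [cite: McCallumLMS1991, §5 Prop. 5.2, Thm. 5.4 (p. 310)] [cite: GrossLMS1991, §5 (5.1)] -/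
theorem exists_shaFamily_W_of_forall_exists_avoiding (hn : n ≠ 0)
    (hdivQ : ∀ P : W.toAffine.Point, ∃ Q : W.toAffine.Point, n • Q = P)
    (hL : ∀ P : (W.baseChange K).toAffine.Point, n • P = 0 → P = 0) {s a : ℕ}
    (havoid : ∀ i < s, ∀ u : Fin i → galH1Torsion (W.baseChange K) n,
      (∀ k, u k ∈ selmerGroup (W.baseChange K) n ∧ conjAct W σ n (u k) = u k) → (∀ k, addOrderOf (u k) = 2 ^ a) →
      ∃ y : galH1Torsion (W.baseChange K) n, (y ∈ selmerGroup (W.baseChange K) n ∧ conjAct W σ n y = y) ∧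
        addOrderOf y = 2 ^ a ∧ Disjoint (zmultiples y) (AddSubgroup.closure (Set.range u))) :
    ∃ x : Fin s → W.galH1, (∀ i, resBaseChange W K (x i) ∈ (W.baseChange K).sha) ∧
      (∀ i, addOrderOf (x i) = 2 ^ a) ∧
      ∀ e : Fin s → ℤ, ∑ i, e i • x i = 0 → ∀ i, ((2 ^ a : ℕ) : ℤ) ∣ e i := by
  -- greedy with the trivial seed
  obtain ⟨z, hP, hord, hind⟩ := exists_indepFamilyMod_of_forall_exists_avoiding (N := 2 ^ a) (s := s)
    (fun y : galH1Torsion (W.baseChange K) n ↦ y ∈ selmerGroup (W.baseChange K) n ∧ conjAct W σ n y = y) ⊥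
    (fun i hi u hPu hordu _ ↦ by
      obtain ⟨y, hPy, hy, hdisj⟩ := havoid i hi u hPu hordu
      exact ⟨y, hPy, hy, dvd_of_zsmul_add_sum_mem_of_disjoint ⊥ u hy (by rwa [sup_bot_eq])⟩)
  exact exists_shaFamily_of_fixed_selmerFamily_of_injective W K h2 σ hσ n hL
    (torsionH1ToH1_injective_of_divisible W hn (by convert hdivQ)) z (fun i ↦ (hP i).1) (fun i ↦ (hP i).2) hord
    (indep_of_indepMod ⊥ z (by exact_mod_cast hind))

end PlusSide

/-! ## §3 The (−) side: a rung of the `Wd`-ladder from avoidance among anti-fixed Selmer classes over `K`, seed `⟨δ(P₀)⟩` -/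

section MinusSide

variable (W : WeierstrassCurve ℚ) (K : Type) [Field K] [NumberField K]
  (h2 : Module.finrank ℚ K = 2) (σ : K ≃ₐ[ℚ] K) (hσ : σ ≠ 1) (L : ℕ)

include h2 hσ in
/-- **A RUNG OF L's `Wd`-LADDER FROM McCALLUM-SHAPED AVOIDANCE OVER `K` (Mordell–Weil side).** `K` quadratic, `σ ≠ 1`, `E/ℚ`
(model `W`) with `E(K)[2^L] = 0`, `Wd` any ℚ-model of `W^{(d_K)}`; `g ∈ E(K)` generating `E(K)` modulo `2^L` and `P₀ ∈ E(K)` with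
`2^L ∤ P₀` (`P₀ = P_1 = y_K`, `L > M₀`; `δ(P₀) = c_L(1)`). If for every `i < s` and every `i` ANTI-FIXED SELMER classes `u_k ∈ H¹(K, E_K[2^L])`
of order `2^a` some anti-fixed Selmer class `y` of order `2^a` has `⟨y⟩ ∩ (⟨u⟩ + ⟨δ(P₀)⟩) = 0`, then there are `y : Fin s → H¹(ℚ, Wd)`
with `res_K y_i ∈ Ш(Wd_K/K)`, `ord y_i = 2^a`, independent modulo `2^a` — the binder `hfam'` of stub L at this rung. (Supplier:
`y = d_{M_{r−1}}(n)` at even depth, McCallum Prop. 5.2 over `K` at `2` with `C ∋ c_L(1)`.)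
[cite: McCallumLMS1991, §5 Prop. 5.2, Thm. 5.4 (p. 310)] [cite: GrossLMS1991, §4 (P_1 = y_K), §5 (5.1)] -/
theorem exists_shaFamily_twin_of_forall_exists_avoiding
    (hdiv : ∀ P : geomPoints (W.baseChange K), ∃ Q : geomPoints (W.baseChange K), ((2 ^ L : ℕ) : ℤ) • Q = P)
    (hL : ∀ P : (W.baseChange K).toAffine.Point, ((2 ^ L : ℕ) : ℤ) • P = 0 → P = 0)
    {Wd : WeierstrassCurve ℚ} (hWd : ∃ C : VariableChange ℚ, C • W.quadraticTwist (NumberField.discr K : ℚ) = Wd)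
    (g : (W.baseChange K).toAffine.Point)
    (hg : ∀ P : (W.baseChange K).toAffine.Point, ∃ (k : ℤ) (Q : (W.baseChange K).toAffine.Point),
      ((2 ^ L : ℕ) : ℤ) • Q = P - k • g)
    (P₀ : (W.baseChange K).toAffine.Point) (hP₀ : ∀ Q : (W.baseChange K).toAffine.Point, ((2 ^ L : ℕ) : ℤ) • Q ≠ P₀)
    {s a : ℕ}
    (havoid : ∀ i < s, ∀ u : Fin i → galH1Torsion (W.baseChange K) ((2 ^ L : ℕ) : ℤ),
      (∀ k, u k ∈ selmerGroup (W.baseChange K) ((2 ^ L : ℕ) : ℤ) ∧ conjAct W σ ((2 ^ L : ℕ) : ℤ) (u k) = -u k) →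
      (∀ k, addOrderOf (u k) = 2 ^ a) →
      ∃ y : galH1Torsion (W.baseChange K) ((2 ^ L : ℕ) : ℤ),
        (y ∈ selmerGroup (W.baseChange K) ((2 ^ L : ℕ) : ℤ) ∧ conjAct W σ ((2 ^ L : ℕ) : ℤ) y = -y) ∧
        addOrderOf y = 2 ^ a ∧
        Disjoint (zmultiples y) (AddSubgroup.closure (Set.range u) ⊔
          zmultiples (kummerMapTorsion (W.baseChange K) ((2 ^ L : ℕ) : ℤ) hdiv P₀))) :
    ∃ y : Fin s → Wd.galH1, (∀ i, resBaseChange Wd K (y i) ∈ (Wd.baseChange K).sha) ∧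
      (∀ i, addOrderOf (y i) = 2 ^ a) ∧
      ∀ e : Fin s → ℤ, ∑ i, e i • y i = 0 → ∀ i, ((2 ^ a : ℕ) : ℤ) ∣ e i := by
  set C₀ : AddSubgroup (galH1Torsion (W.baseChange K) ((2 ^ L : ℕ) : ℤ)) :=
    zmultiples (kummerMapTorsion (W.baseChange K) ((2 ^ L : ℕ) : ℤ) hdiv P₀) with hC₀
  -- greedy with the seed `⟨δ(P₀)⟩`
  obtain ⟨z, hP, hord, hind⟩ := exists_indepFamilyMod_of_forall_exists_avoiding (N := 2 ^ a) (s := s)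
    (fun y : galH1Torsion (W.baseChange K) ((2 ^ L : ℕ) : ℤ) ↦
      y ∈ selmerGroup (W.baseChange K) ((2 ^ L : ℕ) : ℤ) ∧ conjAct W σ ((2 ^ L : ℕ) : ℤ) y = -y) C₀
    (fun i hi u hPu hordu _ ↦ by
      obtain ⟨y, hPy, hy, hdisj⟩ := havoid i hi u hPu hordu
      exact ⟨y, hPy, hy, dvd_of_zsmul_add_sum_mem_of_disjoint C₀ u hy hdisj⟩)
  -- the span of `z` avoids `⟨δ(P₀)⟩`, hence the Kummer kernel
  have hdisj : Disjoint (AddSubgroup.closure (Set.range z)) C₀ := disjoint_closure_range_of_indepMod C₀ z hord hind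
  have hker := sum_zsmul_eq_zero_of_torsionH1ToH1_eq_zero_of_disjoint_kummer (W.baseChange K) hdiv g hg P₀ hP₀ z hdisj
  exact exists_shaFamily_twin_of_antifixed_selmerFamily W K h2 σ hσ _ hL hWd z (fun i ↦ (hP i).1) (fun i ↦ (hP i).2) hker
    hord (indep_of_indepMod C₀ z (by exact_mod_cast hind))

end MinusSide

end Summit.BirchSwinnertonDyer.BirchSwinnertonDyer.Theorems.GenusExact.PlusDescent

end
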